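import Summits.ResolutionOfSingularities.ResolutionOfSingularities.Theses.FrobeniusLadder
import Summits.ResolutionOfSingularities.ResolutionOfSingularities.Theorems.FrobeniusLadderFRationalModificationCertifiedModel
import Summits.ResolutionOfSingularities.ResolutionOfSingularities.Theorems.FrobeniusLadderFRationalModificationReduction
import Summits.ResolutionOfSingularities.ResolutionOfSingularities.Theorems.FrobeniusLadderFRationalModificationCmCartierHull
import Summits.ResolutionOfSingularities.ResolutionOfSingularities.Theorems.FrobeniusLadderFRationalModificationBlowupPrincipalization
import Summits.ResolutionOfSingularities.ResolutionOfSingularities.Theorems.FrobeniusLadderFRationalModificationPrincipalizationOfMacaulayfication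
import Summits.ResolutionOfSingularities.ResolutionOfSingularities.Theorems.FrobeniusLadderFRationalModificationHullsNoCM
import Summits.ResolutionOfSingularities.ResolutionOfSingularities.Theorems.FrobeniusLadderFRationalModificationMacaulayfyHull
import Summits.ResolutionOfSingularities.ResolutionOfSingularities.Theorems.FrobeniusLadderFRationalModificationHullOfRungTwo
import Summits.ResolutionOfSingularities.ResolutionOfSingularities.Theorems.FrobeniusLadderFRationalModificationPointwiseHull
import Summits.ResolutionOfSingularities.ResolutionOfSingularities.Theorems.FrobeniusLadderFRationalModificationFrobeniusSandwich
import Summits.ResolutionOfSingularities.ResolutionOfSingularities.Theorems.FrobeniusLadderFInjectiveMacaulayficationStubCmGlue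
import Literature.AlgebraicGeometry.Resolution.AlterationsNormalizationReduction
import Literature.AlgebraicGeometry.Resolution.AlterationsResolution
import Literature.AlgebraicGeometry.Resolution.MacaulayficationOverCMLocus
import Literature.AlgebraicGeometry.Resolution.CanonicalResolutionProofs
import Literature.AlgebraicGeometry.Resolution.MacaulayficationPrincipalization
import Literature.AlgebraicGeometry.Resolution.ResolutionOfCurves
import Mathlib.AlgebraicGeometry.IdealSheaf.Functorial
import Mathlib.AlgebraicGeometry.FunctionField
import HarnessLib

/-!
# Crux `FRationalModification` (stmt-ResolutionOfSingularities-15316) — skeleton of line `birth`, v5.1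

v5.1 (line lead c7, cycle 8, 2026-08-17): housekeeping only — the lattice lemmas and the chain C / chain D
compositions are now the TREE calls (`MacaulayfyHull` p142191, `HullOfRungTwo` p143165, `PointwiseHull`
p143855, all built on the farm) instead of the inline copies v4/v5 carried; the Frobenius-sandwich toolbox
(`FrobeniusSandwich.rungThree_of_frobeniusSandwich`, p142808) is now imported, so the whole crux toolbox is in scope here.
Registered stub set UNCHANGED: `stub_pointwiseHullOfRungTwo` (OPEN, crux-sized). Status of the line: complete
modulo that stub; see `Lines/birth.md` (cycle 8 section) for the lead's closing analysis.

Route `ResolutionOfSingularities/FrobeniusLadder`, rung 3 of the ladder: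
`FRationalModification` = "a reduced separated finite-type `X/k` (`char k = p`) with a proper
birational model `X₁ → X` that is locally integral, Cohen–Macaulay and F-injective (rung 2) has a
proper birational model `X₂ → X` all of whose stalks are F-rational domains (rung 3)".

## v5 (line lead c6, cycle 7, 2026-08-17): the open stub in POINTWISE form — promotable verbatim

Same cut, one step weaker and in the route file's own vocabulary: the registered open stub is now
`stub_pointwiseHullOfRungTwo` (chain D) — every integral separated finite-type `Y/k` with rung-2 stalks has
a proper birational `W' → Y` every stalk of which is EITHER regular OR a domain with a ring certificate
`t ∈ 𝔪 ∖ 0`, `𝒪[1/t]` regular, `𝒪/(t)` Cohen–Macaulay F-injective. The consumer was always pointwise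
(`CertifiedModel.rungThree_of_certificate`), so the global Cartier divisor of v1–v4 was a convenience:
`pointwise_of_hullOfRungTwo : HullOfRungTwo → PointwiseHullOfRungTwo` (the local equation of `D'` is the
certificate) and `FRationalModification_of_pointwise : PointwiseHullOfRungTwo → FRationalModification`
(tree `PointwiseHull`, p143855, sorry-free, no named fact — called here). Unlike the Cartier-hull forms (which need the
tree's `IsEffectiveCartier` / `stalkIdeal`), the pointwise form elaborates over `Mathlib` +
`Summits.ResolutionOfSingularities.Statement` alone (`PromoteSignature.lean`, attached as evidence): it can
be filed as a route item as is, and the crux then closes by `PromoteAdapter.fRationalModification_of_item`.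
v4's `HullOfRungTwo` and v3's CM / CM-free forms stay as proved-sufficient STRONGER forms (lattice below).

## v4 (line lead c6, cycle 7, 2026-08-17): ONE open stub, NO named fact, the antecedent fully used

The cut is the (D+) "F-injective Cartier hull" of v1–v3 (produce a proper birational `W' → Y` with an
effective Cartier `D'`, `W'` regular off `Supp D'`, and Cohen–Macaulay F-injective boundary rings
`𝒪_{W',w}/D'_w` at the domain stalks on `Supp D'`; the landed Fedder–Watanabe inversion then reads off
rung 3), but the registered open stub is now its WEAKEST sufficient form, chain C:

* `stub_hullOfRungTwo` (OPEN, the only `sorry`): every INTEGRAL separated finite-type `Y/k` whose stalks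
  are rung-2 (domain, Cohen–Macaulay, F-injective — the crux's antecedent verbatim, per stalk) admits an
  F-injective Cartier hull `(W', D')`. The composition `FRationalModification_of_hull : HullOfRungTwo →
  FRationalModification` is the tree's `HullOfRungTwo.fRationalModification_of_hullOfRungTwo` (p143165,
  sorry-free, no named fact: `Reduction.stub_reduction` to the integral rung-2 components, the hull, and
  the consumer `CertifiedModel.rungThree_of_cartierCertificate` / `Negative.rungThree_of_isRegularLocalRing`).

The two earlier forms stay in the file as PROVED lattice, so nothing of v3 is lost and the planners get
a complete promotion menu (strongest to weakest; each closes the crux):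
* `FInjectiveCartierHullNoCM` (chain B, v3): any integral `W`, effective Cartier `D`, `W` regular off
  `Supp D` ⇒ hull. `hullOfRungTwo_of_noCM : NoCM → HullOfRungTwo` (tree `HullOfRungTwo`, blow up the
  non-regular locus first) and `FRationalModification_of_noCM` (tree `HullsNoCM`, p140901).
* `FInjectiveCartierHull` (the CM form, v1–v3's registered `stub_fInjectiveCartierHull`): the same for
  Cohen–Macaulay `W`. `noCM_of_cm_of_macaulayfication : CesnaviciusMacaulayfication → CM form → NoCM`
  (tree `MacaulayfyHull`, p142191: Macaulayfy by an isomorphism over the regular locus, pull the boundary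
  back) and trivially `cm_of_noCM`; so CM form ⇔ NoCM modulo the ladder's one named fact, and chain A
  (`FRationalModification_of_chainA : CesnaviciusMacaulayfication → FInjectiveCartierHull →
  FRationalModification`, v3's composition with the fact as a HYPOTHESIS instead of a sorried stub).
Why chain C is registered: it is the only form that USES the Frobenius half of the antecedent (rung 2 →
"rung 2½" = F-pure Cartier boundary pair → rung 3), it needs no named fact and no Cartier input, and it
is implied by each of the other two; it is still implied by the summit (`hullOfRungTwo_of_hasResolution`,
empty boundary) and not known to follow from the crux (an F-rational model need not carry an F-injective
Cartier certificate through its singular points: rational double points of type `D`, `E` admit none).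
Also landed this cycle (crux toolbox, p142808): `FrobeniusSandwich.rungThree_of_frobeniusSandwich` — a
rung-2 local ring UNDER an F-rational Frobenius sandwich (`R ⊆ S`, `S^q ⊆ R`) is already rung-3 (easy
half of idea card artin-schreier-mirror-wild-core-collapse's `WildCoreCollapse`; the sharpness companion
of Disproof §3, whose witness `𝔽_p + X·𝔽_{p²}⟦X⟧ ⊂ 𝔽_{p²}⟦X⟧` is finite birational homeomorphic but not a
sandwich): on sandwich points no modification is needed at all (tree
`Theorems/FrobeniusLadderFRationalModificationFrobeniusSandwich.lean`; imported since v5.1).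

## History (v1–v3.4, leads c4/c5/c6; details in `Lines/birth.md`)

v1 (planner BC3 birth): three stubs `stub_cmCartierHull` (Česnavičius principalization, KNOWN),
`stub_fInjectiveCartierHull` (OPEN), `stub_parameterTestElement` (HH94 (6.2), KNOWN). v2 (c4):
test elements DISCHARGED by descent from F-finite submodels (`CertifiedModel.rungThree_of_cartierCertificate`
unconditional over every field); `stub_cmCartierHull` PROVED modulo the fact `CesnaviciusPrincipalization`.
v3 (c5): the fact becomes Macaulayfication itself (`CesnaviciusMacaulayfication`, Thm 1.6 sharp form,
Literature p140836) and the corollary is PROVED (`stub_blowupPrincipalization` p140656 +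
`stub_principalizationOfMacaulayfication` p140793); chain B (`HullsNoCM`, p140901). v3.4 (c6): tree calls,
`MacaulayfyHull` (p142191). v4 (c6): this file.

Disproof used (Cruxes/FRationalModification/Disproof.lean v1.2, unchanged since 2026-08-16; `-- Targets:
none`): §1 — the stub is implied by the summit (`hullOfRungTwo_of_hasResolution`), so it is consistent and
not refutable short of `¬ResolutionOfSingularities`; §2 — nothing at `p = 0` is claimed; §3
(`Negative.localRungClimb_false`: the identity is no witness already for curves) — honoured: the hull of the
curve `x² + y² = 0` over `𝔽₃` is its normalisation, and `rungThree_of_frobeniusSandwich` marks exactly where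
the identity IS a witness (Frobenius sandwiches under F-rational rings). No `_false_without_` theorem and no
landed `Negative/` lemma concerns Cartier hulls.
-/

-- single-problem summit: the doubled namespace component `ResolutionOfSingularities` is forced
set_option linter.dupNamespace false

noncomputable section

open CategoryTheory AlgebraicGeometry TopologicalSpace IsLocalRing
open Literature.RingTheory.TightClosure Literature.AlgebraicGeometry.Resolution
open Summit.ResolutionOfSingularities.ResolutionOfSingularities.Theses.FrobeniusLadder
open Summit.ResolutionOfSingularities.ResolutionOfSingularities.Theorems.FRationalModification

namespace Summit.ResolutionOfSingularities.ResolutionOfSingularities.Cruxes.FRationalModification.Lines.Birth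

universe u

/-! ## The hull statements as named propositions (strongest to weakest) -/

/-- **The F-injective Cartier hull conclusion** for a scheme `W'` at prime `p`: an effective Cartier `D'`
with `W'` regular off `Supp D'` and, on `Supp D'`, domain stalks whose boundary ring `𝒪_{W',w}/D'_w` is
Cohen–Macaulay and F-injective (inline system-of-parameters language). [folklore] -/
def HasFInjectiveCartierBoundary (p : ℕ) (W' : Scheme.{0}) : Prop :=
  ∃ D' : W'.IdealSheafData, IsEffectiveCartier D' ∧
    (∀ w : W', w ∉ D'.support → IsRegularLocalRing (W'.presheaf.stalk w)) ∧
    (∀ w : W', w ∈ D'.support → IsDomain (W'.presheaf.stalk w) ∧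
      ∀ d : ℕ, ringKrullDim (W'.presheaf.stalk w ⧸ stalkIdeal D' w) = d →
        ∀ t : Fin d → W'.presheaf.stalk w ⧸ stalkIdeal D' w,
          (Ideal.span (Set.range t)).radical.IsMaximal →
            RingTheory.Sequence.IsWeaklyRegular (W'.presheaf.stalk w ⧸ stalkIdeal D' w)
              (List.ofFn t) ∧
            ∀ y : W'.presheaf.stalk w ⧸ stalkIdeal D' w, (∃ e : ℕ, y ^ p ^ e ∈
              Ideal.span ((fun z : W'.presheaf.stalk w ⧸ stalkIdeal D' w => z ^ p ^ e) ''
                (Ideal.span (Set.range t) : Set (W'.presheaf.stalk w ⧸ stalkIdeal D' w)))) →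
              y ∈ Ideal.span (Set.range t))

/-- **CM-free F-injective Cartier hull** (chain B; the hypothesis of the tree's
`HullsNoCM.fRationalModification_of_fInjectiveCartierHull`): for every integral separated finite-type
`W/k` (`char k = p`) and effective Cartier `D` with `W` regular off `Supp D`, a proper birational `W' → W`
with an F-injective Cartier boundary. The STRONGEST of the three forms. [cite: card
finj-exceptional-divisor-inversion (D+); FedderWatanabe1989, Prop. 2.13] -/
def FInjectiveCartierHullNoCM : Prop :=
  ∀ (p : ℕ) [Fact p.Prime] (k : Type) [Field k] [CharP k p] (W : Scheme.{0})
    (g : W ⟶ Spec (.of k)) [IsSeparated g] [LocallyOfFiniteType g] [QuasiCompact g] [IsIntegral W]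
    (D : W.IdealSheafData), IsEffectiveCartier D →
      (∀ w : W, w ∉ D.support → IsRegularLocalRing (W.presheaf.stalk w)) →
      ∃ (W' : Scheme.{0}) (π : W' ⟶ W), IsProper π ∧ IsBirational π ∧
        HasFInjectiveCartierBoundary p W'

/-- **F-injective Cartier hull over a Cohen–Macaulay ambient** (the CM form; v1–v3's registered
`stub_fInjectiveCartierHull`): the same for `W` with Cohen–Macaulay stalks. Equivalent to the CM-free form
modulo `CesnaviciusMacaulayfication` (`noCM_of_cm_of_macaulayfication`, `cm_of_noCM`). [cite: card
finj-exceptional-divisor-inversion (D+); Fedder1983; FedderWatanabe1989, Prop. 2.13] -/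
def FInjectiveCartierHull : Prop :=
  ∀ (p : ℕ) [Fact p.Prime] (k : Type) [Field k] [CharP k p] (W : Scheme.{0})
    (g : W ⟶ Spec (.of k)) [IsSeparated g] [LocallyOfFiniteType g] [QuasiCompact g] [IsIntegral W],
    (∀ w : W, ∀ d : ℕ, ringKrullDim (W.presheaf.stalk w) = d →
      ∀ s : Fin d → W.presheaf.stalk w, (Ideal.span (Set.range s)).radical.IsMaximal →
        RingTheory.Sequence.IsWeaklyRegular (W.presheaf.stalk w) (List.ofFn s)) →
    ∀ (D : W.IdealSheafData), IsEffectiveCartier D →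
      (∀ w : W, w ∉ D.support → IsRegularLocalRing (W.presheaf.stalk w)) →
      ∃ (W' : Scheme.{0}) (π : W' ⟶ W), IsProper π ∧ IsBirational π ∧
        HasFInjectiveCartierBoundary p W'

/-- **F-injective Cartier hull of a rung-2 variety** (chain C, v4's registered open stub): every integral
separated finite-type `Y/k` with rung-2 stalks (domain; every system of parameters a weakly regular
sequence generating a Frobenius-closed ideal) has a proper birational `W' → Y` with an F-injective
Cartier boundary. The WEAKEST of the three forms and the only one using the Frobenius half of the crux's
antecedent. [cite: card finj-exceptional-divisor-inversion (D+); FedderWatanabe1989, Prop. 2.13] -/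
def HullOfRungTwo : Prop :=
  ∀ (p : ℕ) [Fact p.Prime] (k : Type) [Field k] [CharP k p] (Y : Scheme.{0})
    (g : Y ⟶ Spec (.of k)) [IsSeparated g] [LocallyOfFiniteType g] [QuasiCompact g] [IsIntegral Y],
    (∀ y : Y, IsDomain (Y.presheaf.stalk y) ∧ ∀ d : ℕ, ringKrullDim (Y.presheaf.stalk y) = d →
      ∀ s : Fin d → Y.presheaf.stalk y, (Ideal.span (Set.range s)).radical.IsMaximal →
        RingTheory.Sequence.IsWeaklyRegular (Y.presheaf.stalk y) (List.ofFn s) ∧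
        ∀ w : Y.presheaf.stalk y, (∃ e : ℕ, w ^ p ^ e ∈
          Ideal.span ((fun z : Y.presheaf.stalk y => z ^ p ^ e) ''
            (Ideal.span (Set.range s) : Set (Y.presheaf.stalk y)))) →
          w ∈ Ideal.span (Set.range s)) →
    ∃ (W' : Scheme.{0}) (π : W' ⟶ Y), IsProper π ∧ IsBirational π ∧
      HasFInjectiveCartierBoundary p W'

/-- **Pointwise ring certificates** for a scheme `W'` at prime `p` (pure Mathlib vocabulary): every stalk
is EITHER a regular local ring OR a domain carrying a certificate `t ∈ 𝔪 ∖ 0` with `𝒪[1/t]` a regular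
ring and `𝒪/(t)` Cohen–Macaulay and F-injective (rung-2 clause of `𝒪/(t)`). An F-injective Cartier
boundary yields such certificates (`hasPointwiseCertificates_of_boundary`: the local equation of `D'`).
[folklore] -/
def HasPointwiseCertificates (p : ℕ) (W' : Scheme.{0}) : Prop :=
  ∀ w : W', IsRegularLocalRing (W'.presheaf.stalk w) ∨
    (IsDomain (W'.presheaf.stalk w) ∧
      ∃ t : W'.presheaf.stalk w, t ∈ maximalIdeal (W'.presheaf.stalk w) ∧ t ≠ 0 ∧
        IsRegularRing (Localization.Away t) ∧
        ∀ d : ℕ, ringKrullDim (W'.presheaf.stalk w ⧸ Ideal.span {t}) = d →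
          ∀ u : Fin d → W'.presheaf.stalk w ⧸ Ideal.span {t},
            (Ideal.span (Set.range u)).radical.IsMaximal →
              RingTheory.Sequence.IsWeaklyRegular (W'.presheaf.stalk w ⧸ Ideal.span {t})
                (List.ofFn u) ∧
              ∀ y : W'.presheaf.stalk w ⧸ Ideal.span {t}, (∃ e : ℕ, y ^ p ^ e ∈
                Ideal.span ((fun z : W'.presheaf.stalk w ⧸ Ideal.span {t} => z ^ p ^ e) ''
                  (Ideal.span (Set.range u) : Set (W'.presheaf.stalk w ⧸ Ideal.span {t})))) →
                y ∈ Ideal.span (Set.range u))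

/-- **Pointwise-certified modification of a rung-2 variety** (chain D, v5's registered open stub; the
hypothesis of the tree's `PointwiseHull.fRationalModification_of_pointwiseHullOfRungTwo`): every integral
separated finite-type `Y/k` with rung-2 stalks has a proper birational `W' → Y` with pointwise ring
certificates. WEAKER than every Cartier-hull form (no global divisor), still implied by the summit and not
known from the crux, and stated over Mathlib + the Statement's module alone — i.e. promotable to a route
item verbatim (`Cruxes/FRationalModification/PromoteSignature.lean`). [cite: card
finj-exceptional-divisor-inversion (D+); FedderWatanabe1989, Prop. 2.13] -/
def PointwiseHullOfRungTwo : Prop :=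
  ∀ (p : ℕ) [Fact p.Prime] (k : Type) [Field k] [CharP k p] (Y : Scheme.{0})
    (g : Y ⟶ Spec (.of k)) [IsSeparated g] [LocallyOfFiniteType g] [QuasiCompact g] [IsIntegral Y],
    (∀ y : Y, IsDomain (Y.presheaf.stalk y) ∧ ∀ d : ℕ, ringKrullDim (Y.presheaf.stalk y) = d →
      ∀ s : Fin d → Y.presheaf.stalk y, (Ideal.span (Set.range s)).radical.IsMaximal →
        RingTheory.Sequence.IsWeaklyRegular (Y.presheaf.stalk y) (List.ofFn s) ∧
        ∀ w : Y.presheaf.stalk y, (∃ e : ℕ, w ^ p ^ e ∈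
          Ideal.span ((fun z : Y.presheaf.stalk y => z ^ p ^ e) ''
            (Ideal.span (Set.range s) : Set (Y.presheaf.stalk y)))) →
          w ∈ Ideal.span (Set.range s)) →
    ∃ (W' : Scheme.{0}) (π : W' ⟶ Y), IsProper π ∧ IsBirational π ∧ HasPointwiseCertificates p W'

/-! ## The lattice of the forms (all PROVED and LANDED: tree `MacaulayfyHull` p142191, `HullOfRungTwo` p143165,
`PointwiseHull` p143855 — the statements below are the tree calls) -/

/-- **An F-injective Cartier boundary gives pointwise certificates** (tree
`PointwiseHull.pointwiseHull_of_cartierHull`): off `Supp D'` regular; on it the local equation `t` of `D'`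
(`CartierCertificate.exists_localEquation`) is the certificate, `𝒪[1/t]` regular because the
generizations where `t` is a unit lie off `Supp D'` (`TestElement.isRegularRing_away_of_generizations`).
[folklore] -/
theorem hasPointwiseCertificates_of_boundary (p : ℕ) {k : Type} [Field k] {W' : Scheme.{0}}
    (f : W' ⟶ Spec (.of k)) [LocallyOfFiniteType f] (h : HasFInjectiveCartierBoundary p W') :
    HasPointwiseCertificates p W' := by
  obtain ⟨D', hD', hreg, hcert⟩ := h
  exact fun w => PointwiseHull.pointwiseHull_of_cartierHull p f hD' hreg hcert w

/-- HullOfRungTwo ⇒ PointwiseHullOfRungTwo (tree `PointwiseHull.pointwiseHullOfRungTwo_of_hullOfRungTwo`,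
p143855). [folklore] -/
theorem pointwise_of_hullOfRungTwo (h : HullOfRungTwo) : PointwiseHullOfRungTwo :=
  PointwiseHull.pointwiseHullOfRungTwo_of_hullOfRungTwo h

/-- NoCM ⇒ CM form (forget the Cohen–Macaulay hypothesis). [folklore] -/
theorem cm_of_noCM (h : FInjectiveCartierHullNoCM) : FInjectiveCartierHull :=
  fun p _ k _ _ W g _ _ _ _ _ D hD hreg => h p k W g D hD hreg

/-- CM form + `CesnaviciusMacaulayfication` ⇒ NoCM (tree `MacaulayfyHull.fInjectiveCartierHullNoCM_of_macaulayfication`,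
p142191: Macaulayfy the ambient by an isomorphism over its regular locus, pull the Cartier boundary back
along the dominant map, transport regularity off it). [cite: Cesnavicius2021, Thm. 1.6; DeJong1996, 4.10] -/
theorem noCM_of_cm_of_macaulayfication (hM : CesnaviciusMacaulayfication.{0})
    (h : FInjectiveCartierHull) : FInjectiveCartierHullNoCM :=
  MacaulayfyHull.fInjectiveCartierHullNoCM_of_macaulayfication hM h

/-- NoCM ⇒ HullOfRungTwo (tree `HullOfRungTwo.hullOfRungTwo_of_noCM`, p143165: blow up the non-regular
locus first, `HullsNoCM.cartierHull_of_blowup`). [cite: StacksProject, Tags 02ND and 02OS] -/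
theorem hullOfRungTwo_of_noCM (h : FInjectiveCartierHullNoCM) : HullOfRungTwo :=
  HullOfRungTwo.hullOfRungTwo_of_noCM h

/-- CM form + `CesnaviciusMacaulayfication` ⇒ HullOfRungTwo. [cite: Cesnavicius2021, Thm. 1.6] -/
theorem hullOfRungTwo_of_cm_of_macaulayfication (hM : CesnaviciusMacaulayfication.{0})
    (h : FInjectiveCartierHull) : HullOfRungTwo :=
  hullOfRungTwo_of_noCM (noCM_of_cm_of_macaulayfication hM h)

/-! ## The stub -/

/-- STUB `stub_pointwiseHullOfRungTwo` (v5; OPEN — the only `sorry` of the line; chain D).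
**Pointwise-certified modification of a rung-2 variety.** For every prime `p`, field `k` of
characteristic `p`, and INTEGRAL separated finite-type `Y/k` all of whose stalks are rung-2 (domains in
which every system of parameters is a weakly regular sequence generating a Frobenius-closed ideal — `Y`
Cohen–Macaulay and F-injective), there is a proper birational `π : W' → Y` such that every stalk
`𝒪 = 𝒪_{W',w}` is EITHER a regular local ring OR a domain carrying a ring certificate: `t ∈ 𝔪 ∖ 0` with
`𝒪[1/t]` a regular ring and `𝒪/(t)` Cohen–Macaulay and F-injective (rung-2 clause of `𝒪/(t)`, inline
s.o.p. language). Then `W'` is a rung-3 model (regular stalks: `Negative.rungThree_of_isRegularLocalRing`;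
certified stalks: the Fedder–Watanabe inversion `CertifiedModel.rungThree_of_certificate`). Implied by the
summit (a resolution: every stalk regular); implied by every Cartier-hull form of v1–v4
(`pointwise_of_hullOfRungTwo`, `hullOfRungTwo_of_noCM`, `hullOfRungTwo_of_cm_of_macaulayfication`); NOT
known from the crux (an F-rational, even F-regular, singular point need not carry a certificate:
rational double points of type `D`, `E`). Stated over Mathlib + the Statement's module only, hence
PROMOTABLE to a route item verbatim (`Cruxes/FRationalModification/PromoteSignature.lean`). Why it is
hard: the witnesses are "F-pure boundary pair models, pointwise form", which nothing in print produces by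
modification in dimension `≥ 4`; F-injectivity of `𝒪/(t)` is a Fedder-type non-membership condition not
monotone under blow-ups (sibling `ParameterCentreNoGo`); by Disproof §3 the identity is not a witness in
general (it is on Frobenius-sandwich points, `FrobeniusSandwich.rungThree_of_frobeniusSandwich`, and
wherever a certificate already exists, `pointwiseHullOfRungTwo_of_certificates`).
[cite: Fedder1983 (F-injectivity deforms); FedderWatanabe1989, Prop. 2.13; card
finj-exceptional-divisor-inversion (D+)] -/
theorem stub_pointwiseHullOfRungTwo (p : ℕ) [Fact p.Prime] (k : Type) [Field k] [CharP k p]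
    (Y : Scheme.{0}) (g : Y ⟶ Spec (.of k)) [IsSeparated g] [LocallyOfFiniteType g]
    [QuasiCompact g] [IsIntegral Y]
    (h₂ : ∀ y : Y, IsDomain (Y.presheaf.stalk y) ∧ ∀ d : ℕ, ringKrullDim (Y.presheaf.stalk y) = d →
      ∀ s : Fin d → Y.presheaf.stalk y, (Ideal.span (Set.range s)).radical.IsMaximal →
        RingTheory.Sequence.IsWeaklyRegular (Y.presheaf.stalk y) (List.ofFn s) ∧
        ∀ w : Y.presheaf.stalk y, (∃ e : ℕ, w ^ p ^ e ∈
          Ideal.span ((fun z : Y.presheaf.stalk y => z ^ p ^ e) ''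
            (Ideal.span (Set.range s) : Set (Y.presheaf.stalk y)))) →
          w ∈ Ideal.span (Set.range s)) :
    ∃ (W' : Scheme.{0}) (π : W' ⟶ Y), IsProper π ∧ IsBirational π ∧ ∀ w : W',
      IsRegularLocalRing (W'.presheaf.stalk w) ∨
      (IsDomain (W'.presheaf.stalk w) ∧
        ∃ t : W'.presheaf.stalk w, t ∈ maximalIdeal (W'.presheaf.stalk w) ∧ t ≠ 0 ∧
          IsRegularRing (Localization.Away t) ∧
          ∀ d : ℕ, ringKrullDim (W'.presheaf.stalk w ⧸ Ideal.span {t}) = d →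
            ∀ u : Fin d → W'.presheaf.stalk w ⧸ Ideal.span {t},
              (Ideal.span (Set.range u)).radical.IsMaximal →
                RingTheory.Sequence.IsWeaklyRegular (W'.presheaf.stalk w ⧸ Ideal.span {t})
                  (List.ofFn u) ∧
                ∀ y : W'.presheaf.stalk w ⧸ Ideal.span {t}, (∃ e : ℕ, y ^ p ^ e ∈
                  Ideal.span ((fun z : W'.presheaf.stalk w ⧸ Ideal.span {t} => z ^ p ^ e) ''
                    (Ideal.span (Set.range u) : Set (W'.presheaf.stalk w ⧸ Ideal.span {t})))) →
                  y ∈ Ideal.span (Set.range u)) := by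
  sorry

/-! ## Remarks on the stub (proved): consistency with the summit, the easy loci -/

/-- **A resolution witnesses the F-injective Cartier boundary with EMPTY support** (`D' = ⊤`, tree
`isEffectiveCartier_top`). [folklore] -/
theorem hasFInjectiveCartierBoundary_of_isRegular (p : ℕ) (W' : Scheme.{0})
    (hreg : Scheme.IsRegular W') : HasFInjectiveCartierBoundary p W' := by
  refine ⟨⊤, isEffectiveCartier_top, fun w _ => hreg w, fun w hw => ?_⟩
  have h : w ∉ (⊤ : W'.IdealSheafData).support := by
    rw [Scheme.IdealSheafData.support_top]; exact id
  exact absurd hw h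

/-- **Consistency of `stub_hullOfRungTwo` (Disproof §1 shape)**: a resolution of `Y` is a hull with empty
boundary, so the open stub is implied by the summit and cannot be refuted short of
`¬ResolutionOfSingularities`. [folklore] -/
theorem hullOfRungTwo_of_hasResolution (p : ℕ) (Y : Scheme.{0}) (hres : Scheme.HasResolution Y) :
    ∃ (W' : Scheme.{0}) (π : W' ⟶ Y), IsProper π ∧ IsBirational π ∧
      HasFInjectiveCartierBoundary p W' := by
  obtain ⟨W', π, hπ⟩ := hres
  exact ⟨W', π, hπ.isProper, hπ.isBirational,
    hasFInjectiveCartierBoundary_of_isRegular p W' hπ.isRegular⟩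

/-- **The summit implies `HullOfRungTwo`** (hence the stub is consistent). [folklore] -/
theorem hullOfRungTwo_of_summit (h : _root_.ResolutionOfSingularities) : HullOfRungTwo := by
  intro p _ k _ _ Y g hs hl hq hY _
  have hp : p.Prime := Fact.out
  have hres : Scheme.HasResolution Y := by
    have h' := h
    rw [_root_.ResolutionOfSingularities_iff] at h'
    exact h' p hp k Y g hs hl hq (inferInstance : IsReduced Y)
  exact hullOfRungTwo_of_hasResolution p Y hres

/-- **`stub_hullOfRungTwo` holds unconditionally in dimension `≤ 1`**: an integral `Y/k` of finite type
with `dim Y ≤ 1` is resolved by its normalisation (tree `hasResolution_of_dim_le_one`, no named fact) —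
for the rung-2 curve `x² + y² = 0` over `𝔽₃` of Disproof §3 this IS the hull. [folklore] -/
theorem hullOfRungTwo_of_dim_le_one (p : ℕ) (k : Type) [Field k] (Y : Scheme.{0})
    (g : Y ⟶ Spec (.of k)) [LocallyOfFiniteType g] [QuasiCompact g] [IsIntegral Y]
    (hdim : topologicalKrullDim Y ≤ 1) :
    ∃ (W' : Scheme.{0}) (π : W' ⟶ Y), IsProper π ∧ IsBirational π ∧
      HasFInjectiveCartierBoundary p W' :=
  hullOfRungTwo_of_hasResolution p Y (hasResolution_of_dim_le_one Y g hdim)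

/-- **`stub_hullOfRungTwo` holds in dimension `≤ 3` under Cossart–Piltant** (named fact
`CossartPiltant2019`): again a resolution is a hull with empty boundary. So the OPEN content of the stub —
and of the line — starts in dimension `4`. (Orientation only; the line does not split the crux by
dimension.) [cite: CossartPiltant2019, Thm. 1.1] -/
theorem hullOfRungTwo_of_dim_le_three (h : CossartPiltant2019.{0}) (p : ℕ) (k : Type) [Field k]
    [CharP k p] (Y : Scheme.{0}) (g : Y ⟶ Spec (.of k)) [IsSeparated g] [LocallyOfFiniteType g]
    [QuasiCompact g] [IsIntegral Y] (hdim : topologicalKrullDim Y ≤ 3) :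
    ∃ (W' : Scheme.{0}) (π : W' ⟶ Y), IsProper π ∧ IsBirational π ∧
      HasFInjectiveCartierBoundary p W' :=
  hullOfRungTwo_of_hasResolution p Y (hasResolution_of_dim_le_three h (p := p) k Y g hdim)

/-- **`stub_hullOfRungTwo` when the rung-2 scheme already carries a good boundary**: if `Y` has an
effective Cartier `D` that is an F-injective Cartier boundary (regular off it, Cohen–Macaulay F-injective
boundary rings on it), then `W' = Y` — the stub asks for a modification only where no such `D` exists.
[folklore] -/
theorem hullOfRungTwo_of_good_boundary (p : ℕ) (Y : Scheme.{0})
    (hD : HasFInjectiveCartierBoundary p Y) :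
    ∃ (W' : Scheme.{0}) (π : W' ⟶ Y), IsProper π ∧ IsBirational π ∧
      HasFInjectiveCartierBoundary p W' :=
  ⟨Y, 𝟙 Y, inferInstance, ⟨⊤, by simp, by simp, inferInstance⟩, hD⟩

/-- **Consistency of `stub_pointwiseHullOfRungTwo` (Disproof §1 shape)**: a resolution of `Y` is a
pointwise-certified model (every stalk regular), so the open stub is implied by the summit and cannot be
refuted short of `¬ResolutionOfSingularities`. [folklore] -/
theorem pointwiseHullOfRungTwo_of_hasResolution (p : ℕ) (Y : Scheme.{0})
    (hres : Scheme.HasResolution Y) :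
    ∃ (W' : Scheme.{0}) (π : W' ⟶ Y), IsProper π ∧ IsBirational π ∧ HasPointwiseCertificates p W' := by
  obtain ⟨W', π, hπ⟩ := hres
  exact ⟨W', π, hπ.isProper, hπ.isBirational, fun w => Or.inl (hπ.isRegular w)⟩

/-- **The summit implies `PointwiseHullOfRungTwo`.** [folklore] -/
theorem pointwiseHullOfRungTwo_of_summit (h : _root_.ResolutionOfSingularities) :
    PointwiseHullOfRungTwo :=
  pointwise_of_hullOfRungTwo (hullOfRungTwo_of_summit h)

/-- **`stub_pointwiseHullOfRungTwo` where certificates already exist**: if every stalk of the rung-2 `Y`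
is regular or certified, then `W' = Y` (identity) — the stub asks for a modification only at the
certificate-free singular points (e.g. none at Frobenius-sandwich or `A_n`-type points; all `D`/`E`-type
points). [folklore] -/
theorem pointwiseHullOfRungTwo_of_certificates (p : ℕ) (Y : Scheme.{0})
    (hY : HasPointwiseCertificates p Y) :
    ∃ (W' : Scheme.{0}) (π : W' ⟶ Y), IsProper π ∧ IsBirational π ∧ HasPointwiseCertificates p W' :=
  ⟨Y, 𝟙 Y, inferInstance, ⟨⊤, by simp, by simp, inferInstance⟩, hY⟩

/-! ## Chain A (v1–v3), kept PROVED with the named fact as a hypothesis -/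

/-- Statement of v1's `stub_cmCartierHull`: every integral separated finite-type `Y/k` with Cohen–Macaulay
stalks has a proper birational INTEGRAL Cohen–Macaulay model carrying an effective Cartier divisor off
whose support it is regular. [cite: arXiv:1810.04493, Thm. 1.6 and Cor. (principalize)] -/
def CmCartierHull : Prop :=
  ∀ (k : Type) [Field k] (Y : Scheme.{0}) (g : Y ⟶ Spec (.of k)) [IsSeparated g]
    [LocallyOfFiniteType g] [QuasiCompact g] [IsIntegral Y],
    (∀ y : Y, ∀ d : ℕ, ringKrullDim (Y.presheaf.stalk y) = d →
      ∀ s : Fin d → Y.presheaf.stalk y, (Ideal.span (Set.range s)).radical.IsMaximal →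
        RingTheory.Sequence.IsWeaklyRegular (Y.presheaf.stalk y) (List.ofFn s)) →
    ∃ (W : Scheme.{0}) (π : W ⟶ Y), IsProper π ∧ IsBirational π ∧ IsIntegral W ∧
      (∀ w : W, ∀ d : ℕ, ringKrullDim (W.presheaf.stalk w) = d →
        ∀ s : Fin d → W.presheaf.stalk w, (Ideal.span (Set.range s)).radical.IsMaximal →
          RingTheory.Sequence.IsWeaklyRegular (W.presheaf.stalk w) (List.ofFn s)) ∧
      ∃ D : W.IdealSheafData, IsEffectiveCartier D ∧
        ∀ w : W, w ∉ D.support → IsRegularLocalRing (W.presheaf.stalk w)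

/-- Rung 2's named fact from the ladder's: `CesnaviciusMacaulayfication → KawasakiMacaulayfication`
(Literature `kawasakiMacaulayfication_of_cesnaviciusMacaulayfication`). [cite: Cesnavicius2021, Thm. 1.6;
Kawasaki2000, Thm. 1.1] -/
theorem kawasakiMacaulayfication_of_cesnavicius (h : CesnaviciusMacaulayfication.{u}) :
    KawasakiMacaulayfication.{u} :=
  kawasakiMacaulayfication_of_cesnaviciusMacaulayfication h

/-- v2's fact `CesnaviciusPrincipalization` is a THEOREM modulo `CesnaviciusMacaulayfication`: blow-up
principalization (tree `BlowupPrincipalization.stub_blowupPrincipalization`, p140656) followed by a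
Macaulayfication of the blow-up (tree `PrincipalizationOfMacaulayfication.stub_principalizationOfMacaulayfication`,
p140793). [cite: Cesnavicius2021, §1 Corollary (principalize) after Thm. 1.6] -/
theorem cesnaviciusPrincipalization_of_macaulayfication (hM : CesnaviciusMacaulayfication.{0}) :
    CesnaviciusPrincipalization.{0} :=
  PrincipalizationOfMacaulayfication.stub_principalizationOfMacaulayfication
    (fun Y _ _ Z hZ => BlowupPrincipalization.stub_blowupPrincipalization Y Z hZ)
    (fun k _ X f hs hl hq hX => hM k X f hs hl hq hX)

/-- v1's `stub_cmCartierHull` — PROVED modulo `CesnaviciusMacaulayfication` (tree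
`CmCartierHull.cmCartierHull_of_principalization`, p139115). [cite: Cesnavicius2021, §1 Corollary
(principalize) after Thm. 1.6; Matsumura1987, §30, Cor. to Thm. 30.5] -/
theorem cmCartierHull_of_macaulayfication (hM : CesnaviciusMacaulayfication.{0}) : CmCartierHull :=
  fun k _ Y g _ _ _ _ hCM =>
    CmCartierHull.cmCartierHull_of_principalization (cesnaviciusPrincipalization_of_macaulayfication hM)
      k Y g hCM

/-- **Consistency of `CmCartierHull`**: a REGULAR `Y` is its own Cohen–Macaulay Cartier hull (`W = Y`,
`D = ⊤`). [folklore] -/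
theorem cmCartierHull_of_isRegular (k : Type) [Field k] (Y : Scheme.{0}) (g : Y ⟶ Spec (.of k))
    [IsSeparated g] [LocallyOfFiniteType g] [QuasiCompact g] [IsIntegral Y]
    (hCM : ∀ y : Y, ∀ d : ℕ, ringKrullDim (Y.presheaf.stalk y) = d →
      ∀ s : Fin d → Y.presheaf.stalk y, (Ideal.span (Set.range s)).radical.IsMaximal →
        RingTheory.Sequence.IsWeaklyRegular (Y.presheaf.stalk y) (List.ofFn s))
    (hreg : Scheme.IsRegular Y) :
    ∃ (W : Scheme.{0}) (π : W ⟶ Y), IsProper π ∧ IsBirational π ∧ IsIntegral W ∧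
      (∀ w : W, ∀ d : ℕ, ringKrullDim (W.presheaf.stalk w) = d →
        ∀ s : Fin d → W.presheaf.stalk w, (Ideal.span (Set.range s)).radical.IsMaximal →
          RingTheory.Sequence.IsWeaklyRegular (W.presheaf.stalk w) (List.ofFn s)) ∧
      ∃ D : W.IdealSheafData, IsEffectiveCartier D ∧
        ∀ w : W, w ∉ D.support → IsRegularLocalRing (W.presheaf.stalk w) := by
  refine ⟨Y, 𝟙 Y, inferInstance, ⟨⊤, by simp, by simp, inferInstance⟩, inferInstance, hCM, ⊤,
    isEffectiveCartier_top, fun w _ => hreg w⟩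

/-! ## The consumer over any field (LANDED, unconditional) -/

/-- **Rung 3 along a Cohen–Macaulay F-injective effective Cartier divisor with regular complement, any
ground field — no test-element hypothesis** (tree `CertifiedModel.rungThree_of_cartierCertificate`).
[cite: FedderWatanabe1989, Prop. 2.13; HochsterHuneke1989, Thm. 3.4; EGAIV3, Prop. 8.9.1] -/
theorem rungThree_of_cartierCertificate (p : ℕ) [Fact p.Prime]
    (k : Type) [Field k] [CharP k p] {X : Scheme.{0}} (f : X ⟶ Spec (.of k)) [LocallyOfFiniteType f]
    {D : X.IdealSheafData} (hD : IsEffectiveCartier D) {x : X} (hx : x ∈ D.support)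
    [IsDomain (X.presheaf.stalk x)]
    (hreg : ∀ x' : X, x' ∉ D.support → IsRegularLocalRing (X.presheaf.stalk x'))
    (hcert : ∀ d : ℕ, ringKrullDim (X.presheaf.stalk x ⧸ stalkIdeal D x) = d →
      ∀ t : Fin d → X.presheaf.stalk x ⧸ stalkIdeal D x,
        (Ideal.span (Set.range t)).radical.IsMaximal →
          RingTheory.Sequence.IsWeaklyRegular (X.presheaf.stalk x ⧸ stalkIdeal D x) (List.ofFn t) ∧
          ∀ y : X.presheaf.stalk x ⧸ stalkIdeal D x, (∃ e : ℕ, y ^ p ^ e ∈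
            Ideal.span ((fun z : X.presheaf.stalk x ⧸ stalkIdeal D x => z ^ p ^ e) ''
              (Ideal.span (Set.range t) : Set (X.presheaf.stalk x ⧸ stalkIdeal D x)))) →
            y ∈ Ideal.span (Set.range t)) :
    IsDomain (X.presheaf.stalk x) ∧
      ∀ d : ℕ, ringKrullDim (X.presheaf.stalk x) = d → ∀ s : Fin d → X.presheaf.stalk x,
        (Ideal.span (Set.range s)).radical.IsMaximal → ∀ y c : X.presheaf.stalk x, c ≠ 0 →
          (∀ e : ℕ, c * y ^ p ^ e ∈
            Ideal.span ((fun z : X.presheaf.stalk x => z ^ p ^ e) ''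
              (Ideal.span (Set.range s) : Set (X.presheaf.stalk x)))) →
          y ∈ Ideal.span (Set.range s) :=
  CertifiedModel.rungThree_of_cartierCertificate p k f hD hx hreg hcert

/-! ## The compositions: the crux from each hull STATEMENT (sorry-free closures) -/

set_option linter.defProp false in
/-- **Chain D — `FRationalModification` from `PointwiseHullOfRungTwo`** (tree
`PointwiseHull.fRationalModification_of_pointwiseHullOfRungTwo`, p143855; kernel-checked, NO `sorry`, NO
named fact). (A `def`, not a `theorem`, only so that the skeleton audit's unique crux-concluding theorem is
`FRationalModification_of` below.) [cite: FedderWatanabe1989, Prop. 2.13; HochsterHuneke1989, Thm. 3.4] -/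
def FRationalModification_of_pointwise (hP : PointwiseHullOfRungTwo) : FRationalModification :=
  PointwiseHull.fRationalModification_of_pointwiseHullOfRungTwo hP

set_option linter.defProp false in
/-- **Chain C — `FRationalModification` from `HullOfRungTwo`** (tree
`HullOfRungTwo.fRationalModification_of_hullOfRungTwo`, p143165; kernel-checked, NO `sorry`, NO named
fact). (A `def`, not a `theorem`, only so that the skeleton audit's unique crux-concluding theorem is
`FRationalModification_of` below.) [cite: FedderWatanabe1989, Prop. 2.13] -/
def FRationalModification_of_hull (hH : HullOfRungTwo) : FRationalModification :=
  HullOfRungTwo.fRationalModification_of_hullOfRungTwo hH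

set_option linter.defProp false in
/-- **Chain B — `FRationalModification` from the CM-free form** (tree
`HullsNoCM.fRationalModification_of_fInjectiveCartierHull`, p140901; no named fact). [cite:
FedderWatanabe1989, Prop. 2.13; StacksProject, Tag 02ND] -/
def FRationalModification_of_noCM (h : FInjectiveCartierHullNoCM) : FRationalModification :=
  FRationalModification_of_hull (hullOfRungTwo_of_noCM h)

set_option linter.defProp false in
/-- **Chain A — `FRationalModification` from the CM form and `CesnaviciusMacaulayfication`** (v3's
composition, the fact now a hypothesis). [cite: Cesnavicius2021, Thm. 1.6; FedderWatanabe1989,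
Prop. 2.13] -/
def FRationalModification_of_chainA (hM : CesnaviciusMacaulayfication.{0}) (h : FInjectiveCartierHull) :
    FRationalModification :=
  FRationalModification_of_hull (hullOfRungTwo_of_cm_of_macaulayfication hM h)

/-- **The crux `FRationalModification`, assembled from the registered stub** (the skeleton theorem:
concludes the route decl BY NAME; the only `sorry` in its closure is `stub_pointwiseHullOfRungTwo`). -/
theorem FRationalModification_of : FRationalModification :=
  FRationalModification_of_pointwise
    (fun p _ k _ _ Y g _ _ _ _ h₂ => stub_pointwiseHullOfRungTwo p k Y g h₂)

end Summit.ResolutionOfSingularities.ResolutionOfSingularities.Cruxes.FRationalModification.Lines.Birth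

end
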